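import Literature.MathematicalPhysics.QuantumFieldTheory.Balaban1983to89.B9Eq3132QGtildeQInvLetterClosed
import Literature.MathematicalPhysics.QuantumFieldTheory.Balaban1983to89.B9Eq3126KinvTwoBackgroundLetterTower

/-!
# `Balaban1983to89.B9Eq3132KinvPiSubKinvLetterTower` — T. Bałaban, *Propagators for lattice gauge theories in a background field*, Commun. Math. Phys. **99** (1985) 389–434
# [Balaban1985BackgroundPropagators] (3.132) p. 422 *«The operators (QGQ*)⁻¹, or (QG₁Q*)⁻¹, can be analyzed in the same way as the operator (Q′G′²Q′*)⁻¹»*, (3.126) p. 420,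
# (3.130)–(3.131) pp. 421–422 (*«G = G₀(I − Δ′_πG₀)⁻¹»*), (3.117) p. 419, Thm 3.11 p. 416: **THE SLOT DIFFERENCE OF THE COARSE INVERSES — `K̃_k(U)⁻¹ − K_k(U)⁻¹`,
# `K̃_k = Q_kG̃_kQ_k†` at PRINT's operator (3.122), `K_k = Q_kG₁,kQ_k†` at the chain's (3.26), AT THE SAME BACKGROUND, AS A LOCAL LETTER WITH THE SMALL FACTOR `j₀`
# (the current window (3.36)), CONSTANTS BEFORE `n, η, m, U`**: `‖((K̃_k⁻¹ − K_k⁻¹)z)(c)‖ ≤ j₀·K·e^{−κ·d_m(c₋, v)}·F` — the `K⁻¹`-half of the π-side of ROUTE (J′): by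
# `B9Eq3119DeltaPiTowerFlat` every π-letter at `U ≡ 1` IS the chain's letter, so the two-background rows of print's letters are `(X̃(U) − X(U)) + (X(U) − X(1))`; the second
# summand is gen 101's `B9Eq3126KinvTwoBackgroundLetterTower`, this file is the first for `X = K⁻¹`

statement-level skeleton of published theorems with citation tags; proofs where landed; nothing here is a claim about the Yang–Mills mass gap

CITATION HEADER (lean-in-tree rule).  Audit cell `pub-balaban`, sub-cell `t4`, BINDER row NE9; filed by NE9 crux-team LEAF PROVER 01 (`b2b-balaban-t4-ne9-formalise-leaf-01`, gen 101;
ROUTE (J′), π-side; bears_on: R4/N22).  Composition BY NAME: ne9-leaf-05's (K79) `B9Eq3130GtildeMinusG1kRowsClosed.exists_local_letters_G1LatticeKPi_sub_G1k` (the value row of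
`G̃_k − G₁,k` with the factor `j₀`), (K80) `B9Eq3132QGtildeQInvLetterClosed.exists_local_letter_KinvLatticeKPi` (the letter of `K̃_k⁻¹`), this lineage's
`B9Eq3126KinvTwoBackgroundLetterTower.exists_letter_Kinv` (the letter of `K_k⁻¹`), ne9-leaf-03's `B9Eq315QkSingleBondLetter.norm_adjoint_QkW_apply_le_local_sharp` and
`B9Eq315QkLocalLetter.local_QkW` (the `Q_k†`, `Q_k` letters), ne9-leaf-05's `B9Eq326G1SupRowOfLetters.letter_comp`; `B11Eq103H1Complex.{KinvLatticeK, hK_lattice, greenK_apply}`.  Source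
READ first-hand in the held text layer `paper:balaban1985-cmp99-background-propagators` (journal page = PDF page + 388) pp. 419–422.  NOTHING of print's proofs is reproduced: [folklore] second
resolvent identity + two letter compositions (the pattern of `B9Eq3126KinvTwoBackgroundLetterTower` §2 with `(G̃_k(U), G₁,k(U))` in place of `(G₁,k(U), G₁,k(1))` and ONE shared `Q_k`).

WHAT IS PROVED (sorry-free; proof lane — 0 `def`; [folklore]).
* **`exists_letter_KinvPi_sub_Kinv`** — `∃ α₁ j₁ > 0, K ≥ 0, κ > 0` BEFORE (K80)'s binder block VERBATIM (`… hc₀η j₀ hJ hj hposπ hQ`): for every coarse-bond field `z` supported over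
  `bpos⁻¹(v)` with `‖z(c′)‖ ≤ F` and every coarse bond `c`: `‖((K̃_k⁻¹ − K_k⁻¹)z)(c)‖ ≤ j₀·K·e^{−κ·d_m(c₋,v)}·F`, `K̃_k⁻¹ = KinvLatticeK hposπ hQ`, `K_k⁻¹ = KinvLatticeK hpos hQ` —
  `K̃⁻¹ − K⁻¹ = −K̃⁻¹Q_k(G̃_k − G₁,k)Q_k†K⁻¹`.
HONEST SCOPE.  Composition BY NAME on the cell's MODEL rows (O-NE9-1, #5 UNRULED); constants crude; ONE background; the current window `‖J‖ ≤ j₀ ≤ j₁` and `c₀ = η^d`, the other windows,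
unitarity, the tower data, `hαL`, the positivity and onto witnesses stay HYPOTHESES (how `j₀` is `O(α)` on print's class is lit-balaban's `B9Eq336CurrentBound`, not used here); nothing of
[B9] (3.130)–(3.133) asserted as printed; «NE9 ⇐ the named binders»; NE9 NOT PRINTED ∕ NOT PROVED; spine PROVED 0∕9; rung (B)+1 on a finite T⁴ — NOT infinite volume, NOT mass gap, NOT
BetaPertH, NOT Clay.  HONEST DEPENDENCY: continuum YM on T⁴ ⇐ BetaPertH ∧ nine spine estimates (0/9 proved); BetaPertH ⇐ (D1) ∧ (D4) ∧ CAP+tail; G-an2-4 gates asym, D1 and NE2/3/4.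
NEW file; nothing modified.  Net new unproved facts: 0.
-/

noncomputable section

open scoped InnerProductSpace ComplexConjugate BigOperators

namespace Literature.MathematicalPhysics.QuantumFieldTheory.Balaban1983to89.B9Eq3132KinvPiSubKinvLetterTower

open B4Sect5Torus (TSite tdist tdist_nonneg tdist_triangle tdist_symm torusSum_le tdist_self)
open B4Sect5Proof (latticeConst latticeConst_nonneg)
open B9SectCLatticeCarrier (Bond bpos shift unshift)
open B9Eq311L2Pairing (WL2)
open B9Eq319QprimeTorus (blockCoord)
open B7Prop1Explicit (U1 Wcx boxVec)
open B11Eq103H1Complex (SiteL2K BondL2K greenK_apply G1LatticeK KinvLatticeK hK_lattice)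
open B9Eq310DeltaPrime (plaqHolU)
open B9Eq310HessianOperator (adTransportW)
open B9Eq315QTorus (perCfg cornerSite)
open B9Eq315QTower (towerP UlevOf)
open B9Eq316TowerFlatIsOneStep (towerP_eq_fineP_pow siteCast)
open B9Eq326OperatorTower (QkW laplaceAk G1k)
open B9Eq324DeltaPrimeATower (laplacePrimeAk)
open B9Eq3119DeltaPiTower (laplaceAkPi)
open B9Eq349BlockDistanceWeight (tdist_shift_le_one)
open B9Eq315QkLocalLetter (local_QkW)
open B9Eq315QkSingleBondLetter (norm_adjoint_QkW_apply_le_local_sharp)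
open B9Eq326G1SupRowOfLetters (letter_comp)
open B9Eq3130GtildeMinusG1kRowsClosed (exists_local_letters_G1LatticeKPi_sub_G1k)
open B9Eq3132QGtildeQInvLetterClosed (exists_local_letter_KinvLatticeKPi)
open B9Eq3126KinvTwoBackgroundLetterTower (exists_letter_Kinv)

variable {d : ℕ} (hd : 1 ≤ d) (L : ℕ) [NeZero L] (hL : 1 ≤ L) (hL3 : 3 ≤ L)
  {𝔸 : Type*} [NormedRing 𝔸] [NormedAlgebra ℂ 𝔸] [CompleteSpace 𝔸] [NormOneClass 𝔸] [StarRing 𝔸] [NormedStarGroup 𝔸] [StarModule ℂ 𝔸]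
  {W : Type*} [NormedAddCommGroup W] [InnerProductSpace ℂ W] [FiniteDimensional ℂ W] (φ : W ≃ₗ[ℂ] 𝔸)
  {Mφ Mφ' : ℝ} (hMφ : 0 ≤ Mφ) (hMφ' : 0 ≤ Mφ') (hφ : ∀ w, ‖φ w‖ ≤ Mφ * ‖w‖) (hφ' : ∀ X, ‖φ.symm X‖ ≤ Mφ' * ‖X‖) (hstar : ∀ X : 𝔸, ‖star X‖ ≤ ‖X‖)
  {a : ℝ} (ha : 0 < a) {a' : ℝ} (ha' : 0 < a') {ϱ : ℝ} (hϱ0 : 0 ≤ ϱ) (hϱ1 : ϱ < 1)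
  (τ : 𝔸 →ₗ[ℂ] ℂ) {Cτ : ℝ} (hτ : ∀ X, ‖τ X‖ ≤ Cτ * ‖X‖) (hCτ : 0 ≤ Cτ) {Mτ : ℝ} (hτm : ∀ X Y : 𝔸, ‖τ (X * Y)‖ ≤ Mτ * ‖X‖ * ‖Y‖) (hMτ : 0 ≤ Mτ)
  {ρw : ℝ} (hρw : 0 ≤ ρw)
  (hτ₁ : ∀ X : 𝔸, τ (star X) = conj (τ X)) (hτ₂ : ∀ X Y : 𝔸, τ (X * Y) = τ (Y * X)) (hφτ : ∀ X Y : 𝔸, ⟪φ.symm X, φ.symm Y⟫_ℂ = τ (star X * Y))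
  (AQ : ℝ)

include hd hL hL3 hMφ hMφ' hφ hφ' hstar ha ha' hϱ0 hϱ1 hτ hCτ hτm hMτ hρw hτ₁ hτ₂ hφτ in
set_option maxHeartbeats 3200000 in
set_option maxRecDepth 8192 in
/-- **THE SLOT DIFFERENCE `K̃_k(U)⁻¹ − K_k(U)⁻¹` AS A LOCAL LETTER WITH THE FACTOR `j₀`** — see the module docstring. [folklore]
[cite: Balaban1985BackgroundPropagators, (3.132) p.422, (3.126) p.420, (3.130)–(3.131) pp.421–422, (3.117) p.419, Thm 3.11 p.416] -/
theorem exists_letter_KinvPi_sub_Kinv :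
    ∃ α₁ j₁ K κ : ℝ, 0 < α₁ ∧ 0 < j₁ ∧ 0 ≤ K ∧ 0 < κ ∧
      ∀ (n : ℕ) (η : ℝ) (_hηL : η * (L : ℝ) ^ (n + 1) = 1) (c₀ c₁ : ℝ) [Fact (0 < c₀)] [Fact (0 < c₁)]
        (_hw : c₀ * ((L : ℝ) ^ (n + 1)) ^ d = c₁) (_hρ : |η| ^ d / c₀ ≤ ρw) (m : Fin d → ℕ) [∀ i, NeZero (m i)] (_hm : ∀ i, 1 ≤ m i)
        (U : Bond d (towerP L m (n + 1)) → 𝔸ˣ) (αU : ℕ → ℝ) (_hα0 : ∀ j, 0 ≤ αU j) (hα1 : ∀ j, αU j ≤ 1 / 64)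
        (hαL : ∀ j, 50 * (d + 1) * αU j * (L : ℝ) ^ d ≤ 1 / 2)
        (hU1 : ∀ (j : ℕ) (x : B7Prop1Explicit.Site d) (k : Fin d), perCfg (towerP L m (j + 1)) (UlevOf L m (n + 1) U j) x k ∈ U1 𝔸)
        (hreg : ∀ (j : ℕ) (y : TSite d (towerP L m j)) (k : Fin d) (ρ' : Fin d → Fin L),
          ‖((Wcx L (perCfg (towerP L m (j + 1)) (UlevOf L m (n + 1) U j)) (cornerSite L y) k (boxVec L ρ') : 𝔸ˣ) : 𝔸) - 1‖ ≤ αU j)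
        (εU : ℕ → ℝ) (_hεU : ∀ j, 0 ≤ εU j) (_hUε : ∀ (j : ℕ) (b : Bond d (towerP L m (j + 1))), ‖(UlevOf L m (n + 1) U j b : 𝔸) - 1‖ ≤ εU j)
        (_hLb : ∀ (j : ℕ) (b : Bond d (towerP L m (j + 1))), UlevOf L m (n + 1) U j b ∈ U1 𝔸)
        (α : ℝ) (_hα : 0 ≤ α) (_hαle : α ≤ α₁)
        (hUst : ∀ b, star (U b : 𝔸) = (((U b)⁻¹ : 𝔸ˣ) : 𝔸)) (_hUb : ∀ b, U b ∈ U1 𝔸) (_hUη : ∀ b, ‖(U b : 𝔸) - 1‖ ≤ α * η)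
        (_hpl : ∀ p : B9SectCLatticeCarrier.Plaq d (towerP L m (n + 1)), ‖(plaqHolU U p : 𝔸) - 1‖ ≤ α * η ^ 2)
        (_hUgrad : ∀ (x : TSite d (towerP L m (n + 1))) (μ : Fin d), ‖(U (x, μ) : 𝔸) - U (unshift μ x, μ)‖ ≤ α * η ^ 2)
        (_hRlev : ∀ (j : ℕ) (b : Bond d (towerP L m (j + 1))) (w : W), ‖adTransportW φ (UlevOf L m (n + 1) U j) b w‖ ≤ ‖w‖)
        (_hεg : ∀ j < n + 1, εU j ≤ α * ϱ ^ j) (_hAQ : ∑ j ∈ Finset.range (n + 1), αU j ≤ AQ)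
        (hpos' : ∀ x : SiteL2K ℂ d (towerP L m (n + 1)) c₀ W, x ≠ 0 → 0 < RCLike.re ⟪x, laplacePrimeAk L m n φ η U a' (c₁ := c₁) x⟫_ℂ)
        (hpos : ∀ x : BondL2K ℂ d (towerP L m (n + 1)) c₀ W, x ≠ 0 →
          0 < RCLike.re ⟪x, laplaceAk L m n φ η U hL αU hα1 hU1 hreg τ (c₀ := c₀) (c₁ := c₁) a x⟫_ℂ)
        (_hc₀η : c₀ = η ^ d) (j₀ : ℝ) (_hJ : ∀ μ y, ‖B9Eq39Adjoint.J (fun μ => B9Eq33CovDerivVector.shiftEquiv μ) (fun μ y => U (y, μ)) η μ y‖ ≤ j₀) (_hj : j₀ ≤ j₁)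
        (hposπ : ∀ x : BondL2K ℂ d (towerP L m (n + 1)) c₀ W, x ≠ 0 →
          0 < RCLike.re ⟪x, laplaceAkPi L m n φ τ η U a' hpos' hL αU hα1 hU1 hreg (c₁ := c₁) a x⟫_ℂ)
        (hQ : Function.Surjective (QkW L m n φ U hL αU hα1 hU1 hreg (c₀ := c₀) (c₁ := c₁)))
        (v : TSite d m) (z : BondL2K ℂ d m c₁ W) (F : ℝ)
        (_hzv : ∀ c', bpos c' ≠ v → WL2.equiv ℂ (fun _ : Bond d m => c₁) W z c' = 0)
        (_hzF : ∀ c', ‖WL2.equiv ℂ (fun _ : Bond d m => c₁) W z c'‖ ≤ F) (c : Bond d m),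
        ‖WL2.equiv ℂ (fun _ : Bond d m => c₁) W (KinvLatticeK hposπ hQ z - KinvLatticeK hpos hQ z) c‖ ≤
          j₀ * K * Real.exp (-(κ * tdist m (bpos c) v)) * F := by
  classical
  -- (0) the suppliers, `∃`-first
  obtain ⟨αD, jD, CD, δD, hαD, hjD, hCD, hδD, HD⟩ :=
    exists_local_letters_G1LatticeKPi_sub_G1k hd L hL hL3 φ hMφ hMφ' hφ hφ' hstar ha ha' hϱ0 hϱ1 τ hτ hCτ hτm hMτ hρw hτ₁ hτ₂ hφτ AQ
  obtain ⟨αP, jP, BP, δP, hαP, hjP, hBP, hδP, HP⟩ :=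
    exists_local_letter_KinvLatticeKPi hd L hL hL3 φ hMφ hMφ' hφ hφ' hstar ha ha' hϱ0 hϱ1 τ hτ hCτ hτm hMτ hρw hτ₁ hτ₂ hφτ AQ
  obtain ⟨αK, AK, rK, hαK, hAK, hrK, HK⟩ :=
    exists_letter_Kinv hd L hL hL3 φ hMφ hMφ' hφ hφ' hstar ha ha' hϱ0 hϱ1 τ hτ hCτ hτm hMτ hρw hτ₁ hτ₂ hφτ
  set κ₀ : ℝ := min δD (min δP rK) with hκ₀
  have hκ₀0 : 0 < κ₀ := lt_min hδD (lt_min hδP hrK)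
  have hκ₀D : κ₀ ≤ δD := min_le_left _ _
  have hκ₀P : κ₀ ≤ δP := (min_le_right _ _).trans (min_le_left _ _)
  have hκ₀K : κ₀ ≤ rK := (min_le_right _ _).trans (min_le_right _ _)
  set S : ℝ := latticeConst d (κ₀ / 2) with hS
  have hS0 : 0 ≤ S := latticeConst_nonneg d (half_pos hκ₀0).le
  set EA : ℝ := Real.exp (100 * d * (d + 1) * (L : ℝ) ^ d * AQ) with hEA
  set KSU : ℝ := Mφ' * Mφ * EA * ((2 * d : ℕ) : ℝ) * Real.exp κ₀ with hKSU
  set KQU : ℝ := Mφ' * Mφ * Real.exp (50 * ((d : ℝ) + 1) * AQ) * Real.exp κ₀ with hKQU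
  have hKSU0 : 0 ≤ KSU := by positivity
  have hKQU0 : 0 ≤ KQU := by positivity
  set K : ℝ := AK * KSU * S * CD * S * KQU * S * BP * S with hK
  have hK0 : 0 ≤ K := by positivity
  refine ⟨min αD (min αP αK), min jD jP, K, κ₀ / 2, lt_min hαD (lt_min hαP hαK), lt_min hjD hjP, hK0, half_pos hκ₀0, ?_⟩
  intro n η hηL c₀ c₁ _ _ hw hρ m _ hm U αU hα0 hα1 hαL hU1 hreg εU hεU hUε hLb α hα hαle hUst hUb hUη hpl hUgrad hRlev hεg hAQ hpos' hpos hc₀η j₀ hJ hj hposπ hQ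
    v z F hzv hzF c
  have hαD' : α ≤ αD := hαle.trans (min_le_left _ _)
  have hαP' : α ≤ αP := hαle.trans ((min_le_right _ _).trans (min_le_left _ _))
  have hαK' : α ≤ αK := hαle.trans ((min_le_right _ _).trans (min_le_right _ _))
  have hjD' : j₀ ≤ jD := hj.trans (min_le_left _ _)
  have hjP' : j₀ ≤ jP := hj.trans (min_le_right _ _)
  have hc₀ : (0 : ℝ) < c₀ := Fact.out
  have hLd : (0 : ℝ) < ((L : ℝ) ^ (n + 1)) ^ d := by
    have : (0 : ℝ) < L := by exact_mod_cast hL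
    positivity
  haveI : Nonempty (Bond d m) := ⟨c⟩
  have y₀ : TSite d (towerP L m (n + 1)) := fun _ => 0
  haveI : Nonempty (Bond d (towerP L m (n + 1))) := ⟨(y₀, ⟨0, hd⟩)⟩
  have hF : 0 ≤ F := (norm_nonneg _).trans (hzF c)
  have hj₀ : 0 ≤ j₀ := (norm_nonneg _).trans (hJ ⟨0, hd⟩ y₀)
  -- names
  set piS : TSite d (towerP L m (n + 1)) → TSite d m := fun x => blockCoord (L ^ (n + 1)) m (siteCast (towerP_eq_fineP_pow L m (n + 1)) x) with hpiS
  set piB : Bond d (towerP L m (n + 1)) → TSite d m := fun b' => piS (bpos b') with hpiB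
  set piC : Bond d m → TSite d m := fun c' => c'.1 with hpiC
  set GU := G1k L m n φ η U hL αU hα1 hU1 hreg τ (c₀ := c₀) (c₁ := c₁) hpos with hGU
  set Gt := G1LatticeK hposπ with hGt
  set QU := QkW L m n φ U hL αU hα1 hU1 hreg (c₀ := c₀) (c₁ := c₁) with hQU'
  set KU := KinvLatticeK hpos hQ with hKU
  set Kp := KinvLatticeK hposπ hQ with hKp
  -- the CLMs
  obtain ⟨TGd, hTGd⟩ : ∃ T : BondL2K ℂ d (towerP L m (n + 1)) c₀ W →L[ℂ] BondL2K ℂ d (towerP L m (n + 1)) c₀ W, T = LinearMap.toContinuousLinearMap (Gt - GU) :=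
    ⟨_, rfl⟩
  obtain ⟨TQU, hTQU⟩ : ∃ T : BondL2K ℂ d (towerP L m (n + 1)) c₀ W →L[ℂ] BondL2K ℂ d m c₁ W, T = LinearMap.toContinuousLinearMap QU := ⟨_, rfl⟩
  obtain ⟨SU, hSU⟩ : ∃ T : BondL2K ℂ d m c₁ W →L[ℂ] BondL2K ℂ d (towerP L m (n + 1)) c₀ W, T = LinearMap.toContinuousLinearMap (LinearMap.adjoint QU) := ⟨_, rfl⟩
  obtain ⟨KUcl, hKUcl⟩ : ∃ T : BondL2K ℂ d m c₁ W →L[ℂ] BondL2K ℂ d m c₁ W, T = LinearMap.toContinuousLinearMap KU := ⟨_, rfl⟩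
  obtain ⟨Kpcl, hKpcl⟩ : ∃ T : BondL2K ℂ d m c₁ W →L[ℂ] BondL2K ℂ d m c₁ W, T = LinearMap.toContinuousLinearMap Kp := ⟨_, rfl⟩
  -- (1) the letters at the common rate `κ₀`
  have hweak : ∀ {r' : ℝ} (t : ℝ), κ₀ ≤ r' → 0 ≤ t → Real.exp (-(r' * t)) ≤ Real.exp (-(κ₀ * t)) := fun t hr ht => Real.exp_le_exp.mpr (by nlinarith)
  have hcomp : ∀ {D : ℝ}, D ≤ 1 → (1 : ℝ) ≤ Real.exp κ₀ * Real.exp (-(κ₀ * D)) := fun {D} hD => by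
    rw [← Real.exp_add]; exact Real.one_le_exp (by nlinarith [mul_le_mul_of_nonneg_left hD hκ₀0.le])
  -- (L)(G̃_k − G₁,k; j₀·CD, κ₀)
  have hLGd : ∀ (w : TSite d m) (f : BondL2K ℂ d (towerP L m (n + 1)) c₀ W) (F : ℝ), (∀ x, piB x ≠ w → WL2.equiv ℂ (fun _ : Bond d (towerP L m (n + 1)) => c₀) W f x = 0) →
      (∀ x, ‖WL2.equiv ℂ (fun _ : Bond d (towerP L m (n + 1)) => c₀) W f x‖ ≤ F) →
      ∀ b', ‖WL2.equiv ℂ (fun _ : Bond d (towerP L m (n + 1)) => c₀) W (TGd f) b'‖ ≤ (j₀ * CD) * Real.exp (-(κ₀ * tdist m (piB b') w)) * F := by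
    intro w f F hfv hfF b'
    have hF : 0 ≤ F := (norm_nonneg _).trans (hfF b')
    rw [hTGd, LinearMap.coe_toContinuousLinearMap', LinearMap.sub_apply]
    refine ((HD n η hηL c₀ c₁ hw hρ m hm U αU hα0 hα1 hU1 hreg εU hεU hUε hLb α hα hαD' hUst hUb hUη hpl hUgrad hRlev hεg hAQ hpos' hpos hc₀η j₀ hJ hjD' hposπ
      w f F hfv hfF b' y₀).1).trans ?_
    exact mul_le_mul_of_nonneg_right (mul_le_mul_of_nonneg_left (hweak _ hκ₀D (tdist_nonneg m _ _)) (mul_nonneg hj₀ hCD)) hF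
  -- (L)(Q_k(U); KQU, κ₀)
  have hPA : ∏ j ∈ Finset.range (n + 1), (1 + 50 * ((d : ℝ) + 1) * αU j) ≤ Real.exp (50 * ((d : ℝ) + 1) * AQ) := by
    calc ∏ j ∈ Finset.range (n + 1), (1 + 50 * ((d : ℝ) + 1) * αU j) ≤ ∏ j ∈ Finset.range (n + 1), Real.exp (50 * ((d : ℝ) + 1) * αU j) :=
          Finset.prod_le_prod (fun j _ => by have := hα0 j; positivity) fun j _ => by linarith [Real.add_one_le_exp (50 * ((d : ℝ) + 1) * αU j)]
      _ = Real.exp (50 * ((d : ℝ) + 1) * ∑ j ∈ Finset.range (n + 1), αU j) := by rw [← Real.exp_sum, Finset.mul_sum]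
      _ ≤ Real.exp (50 * ((d : ℝ) + 1) * AQ) := Real.exp_le_exp.mpr (mul_le_mul_of_nonneg_left hAQ (by positivity))
  have hLQU : ∀ (w : TSite d m) (f : BondL2K ℂ d (towerP L m (n + 1)) c₀ W) (F : ℝ), (∀ x, piB x ≠ w → WL2.equiv ℂ (fun _ : Bond d (towerP L m (n + 1)) => c₀) W f x = 0) →
      (∀ x, ‖WL2.equiv ℂ (fun _ : Bond d (towerP L m (n + 1)) => c₀) W f x‖ ≤ F) →
      ∀ c', ‖WL2.equiv ℂ (fun _ : Bond d m => c₁) W (TQU f) c'‖ ≤ KQU * Real.exp (-(κ₀ * tdist m (piC c') w)) * F := by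
    intro w f F hfv hfF c'
    have hF : 0 ≤ F := (norm_nonneg _).trans (hfF (y₀, ⟨0, hd⟩))
    rw [hTQU, LinearMap.coe_toContinuousLinearMap']
    have h := local_QkW L m n φ U hL αU hα1 hU1 hreg (c₀ := c₀) (c₁ := c₁) hφ hφ' hMφ hMφ' hm hκ₀0.le w f F hfv hfF c'
    refine h.trans ?_
    have hE0 : 0 ≤ Real.exp κ₀ * Real.exp (-(κ₀ * tdist m (bpos c') w)) * F := by positivity
    calc Mφ' * Mφ * (∏ j ∈ Finset.range (n + 1), (1 + 50 * ((d : ℝ) + 1) * αU j)) * Real.exp κ₀ * Real.exp (-(κ₀ * tdist m (bpos c') w)) * F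
        = Mφ' * Mφ * (∏ j ∈ Finset.range (n + 1), (1 + 50 * ((d : ℝ) + 1) * αU j)) * (Real.exp κ₀ * Real.exp (-(κ₀ * tdist m (bpos c') w)) * F) := by ring
      _ ≤ Mφ' * Mφ * Real.exp (50 * ((d : ℝ) + 1) * AQ) * (Real.exp κ₀ * Real.exp (-(κ₀ * tdist m (bpos c') w)) * F) := by gcongr
      _ = KQU * Real.exp (-(κ₀ * tdist m (piC c') w)) * F := by rw [hKQU, hpiC]; simp only [bpos]; ring
  -- (L)(Q_k(U)†; KSU, κ₀) on coarse-bond sources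
  have hzone : ∀ (w : TSite d m) (h : BondL2K ℂ d m c₁ W) (H : ℝ), (∀ c', piC c' ≠ w → WL2.equiv ℂ (fun _ : Bond d m => c₁) W h c' = 0) →
      (∀ c', ‖WL2.equiv ℂ (fun _ : Bond d m => c₁) W h c'‖ ≤ H) → ∀ (b' : Bond d (towerP L m (n + 1))) (c' : Bond d m),
      (blockCoord (L ^ (n + 1)) m (siteCast (towerP_eq_fineP_pow L m (n + 1)) b'.1) = c'.1 ∨
        blockCoord (L ^ (n + 1)) m (siteCast (towerP_eq_fineP_pow L m (n + 1)) b'.1) = shift c'.2 c'.1) →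
      ‖WL2.equiv ℂ (fun _ : Bond d m => c₁) W h c'‖ ≤ Real.exp κ₀ * Real.exp (-(κ₀ * tdist m (piB b') w)) * H := by
    intro w h H hhv hhF b' c' hc
    have hH : 0 ≤ H := (norm_nonneg _).trans (hhF c')
    by_cases hcw : c'.1 = w
    · have hD : tdist m (piB b') w ≤ 1 := by
        show tdist m (blockCoord (L ^ (n + 1)) m (siteCast (towerP_eq_fineP_pow L m (n + 1)) b'.1)) w ≤ 1
        rcases hc with hc | hc
        · rw [hc, hcw, tdist_self]; exact zero_le_one
        · rw [hc, ← hcw, tdist_symm hm]; exact tdist_shift_le_one hm c'.1 c'.2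
      calc ‖WL2.equiv ℂ (fun _ : Bond d m => c₁) W h c'‖ ≤ 1 * H := by rw [one_mul]; exact hhF c'
        _ ≤ (Real.exp κ₀ * Real.exp (-(κ₀ * tdist m (piB b') w))) * H := mul_le_mul_of_nonneg_right (hcomp hD) hH
        _ = _ := by ring
    · rw [hhv c' hcw, norm_zero]; positivity
  have hLSU : ∀ (w : TSite d m) (h : BondL2K ℂ d m c₁ W) (H : ℝ), (∀ c', piC c' ≠ w → WL2.equiv ℂ (fun _ : Bond d m => c₁) W h c' = 0) →
      (∀ c', ‖WL2.equiv ℂ (fun _ : Bond d m => c₁) W h c'‖ ≤ H) →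
      ∀ b', ‖WL2.equiv ℂ (fun _ : Bond d (towerP L m (n + 1)) => c₀) W (SU h) b'‖ ≤ KSU * Real.exp (-(κ₀ * tdist m (piB b') w)) * H := by
    intro w h H hhv hhF b'
    have hH : 0 ≤ H := (norm_nonneg _).trans (hhF (w, ⟨0, hd⟩))
    rw [hSU, LinearMap.coe_toContinuousLinearMap']
    have hM : 0 ≤ Real.exp κ₀ * Real.exp (-(κ₀ * tdist m (piB b') w)) * H := by positivity
    have h1 := norm_adjoint_QkW_apply_le_local_sharp (c₀ := c₀) (c₁ := c₁) L m n φ U hL αU hα0 hα1 hU1 hreg hMφ hφ hMφ' hφ' hAQ h b' hM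
      (hzone w h H hhv hhF b')
    have he : c₁ / c₀ * (Mφ' * ((((L : ℝ) ^ (n + 1)) ^ d)⁻¹ * Real.exp (100 * d * (d + 1) * (L : ℝ) ^ d * AQ)) * Mφ) = Mφ' * Mφ * EA := by
      rw [hEA, ← hw]; field_simp
    rw [he] at h1
    exact h1.trans (le_of_eq (by rw [hKSU]; ring))
  -- (L)(K_k⁻¹; AK, κ₀), (L)(K̃_k⁻¹; BP, κ₀) on the coarse bonds
  have hLKU : ∀ (w : TSite d m) (h : BondL2K ℂ d m c₁ W) (H : ℝ), (∀ c', piC c' ≠ w → WL2.equiv ℂ (fun _ : Bond d m => c₁) W h c' = 0) →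
      (∀ c', ‖WL2.equiv ℂ (fun _ : Bond d m => c₁) W h c'‖ ≤ H) →
      ∀ c', ‖WL2.equiv ℂ (fun _ : Bond d m => c₁) W (KUcl h) c'‖ ≤ AK * Real.exp (-(κ₀ * tdist m (piC c') w)) * H := by
    intro w h H hhv hhF c'
    have hH : 0 ≤ H := (norm_nonneg _).trans (hhF c')
    rw [hKUcl, LinearMap.coe_toContinuousLinearMap']
    refine (HK n η hηL c₀ c₁ hw hρ m hm U αU hα0 hα1 hαL hU1 hreg εU hεU hUε hLb α hα hαK' hUst hUb hUη hpl hεg hpos hQ w h H hhv hhF c').trans ?_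
    exact mul_le_mul_of_nonneg_right (mul_le_mul_of_nonneg_left (hweak _ hκ₀K (tdist_nonneg m _ _)) hAK) hH
  have hLKp : ∀ (w : TSite d m) (h : BondL2K ℂ d m c₁ W) (H : ℝ), (∀ c', piC c' ≠ w → WL2.equiv ℂ (fun _ : Bond d m => c₁) W h c' = 0) →
      (∀ c', ‖WL2.equiv ℂ (fun _ : Bond d m => c₁) W h c'‖ ≤ H) →
      ∀ c', ‖WL2.equiv ℂ (fun _ : Bond d m => c₁) W (Kpcl h) c'‖ ≤ BP * Real.exp (-(κ₀ * tdist m (piC c') w)) * H := by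
    intro w h H hhv hhF c'
    have hH : 0 ≤ H := (norm_nonneg _).trans (hhF c')
    rw [hKpcl, LinearMap.coe_toContinuousLinearMap']
    refine (HP n η hηL c₀ c₁ hw hρ m hm U αU hα0 hα1 hαL hU1 hreg εU hεU hUε hLb α hα hαP' hUst hUb hUη hpl hUgrad hRlev hεg hAQ hpos' hpos hc₀η j₀ hJ hjP' hposπ hQ
      w h H hhv hhF c').trans ?_
    exact mul_le_mul_of_nonneg_right (mul_le_mul_of_nonneg_left (hweak _ hκ₀P (tdist_nonneg m _ _)) hBP) hH
  -- (2) the compositions `K̃⁻¹ ∘ Q ∘ (G̃ − G) ∘ Q† ∘ K⁻¹`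
  have hrow : ∀ w : TSite d m, ∑ u, Real.exp (-((κ₀ - κ₀ / 2) * tdist m w u)) ≤ S := fun w => by
    rw [show κ₀ - κ₀ / 2 = κ₀ / 2 by ring]; exact torusSum_le d hm (half_pos hκ₀0) w
  have hδ0 : ∀ u v : TSite d m, 0 ≤ tdist m u v := fun u v => tdist_nonneg _ _ _
  have hδt : ∀ u y v : TSite d m, tdist m u v ≤ tdist m u y + tdist m y v := fun u y v => tdist_triangle hm u y v
  have hκ'0 : (0 : ℝ) ≤ κ₀ / 2 := by positivity
  have hκ'1 : κ₀ / 2 ≤ κ₀ := by linarith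
  have hc1 := letter_comp (𝕜 := ℂ) (tdist m) piC piC piB KUcl SU hδ0 hδt hAK hKSU0 hκ'0 hκ'1 hLKU hLSU hrow
  have hc2 := letter_comp (𝕜 := ℂ) (tdist m) piC piB piB (SU ∘L KUcl) TGd hδ0 hδt (by positivity) (mul_nonneg hj₀ hCD) hκ'0 le_rfl hc1 hLGd hrow
  have hc3 := letter_comp (𝕜 := ℂ) (tdist m) piC piB piC (TGd ∘L (SU ∘L KUcl)) TQU hδ0 hδt (by positivity) hKQU0 hκ'0 le_rfl hc2 hLQU hrow
  have hc4 := letter_comp (𝕜 := ℂ) (tdist m) piC piC piC (TQU ∘L (TGd ∘L (SU ∘L KUcl))) Kpcl hδ0 hδt (by positivity) hBP hκ'0 le_rfl hc3 hLKp hrow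
    v z F hzv hzF c
  -- (3) the second resolvent identity `K̃⁻¹ − K⁻¹ = −K̃⁻¹Q(G̃ − G)Q†K⁻¹`
  have hR : QU (GU (LinearMap.adjoint QU (KU z))) = z := hK_lattice hpos hQ z
  have hL' : ∀ w, Kp (QU (Gt (LinearMap.adjoint QU w))) = w := fun w => by
    rw [hKp, hGt]
    unfold KinvLatticeK B11Eq103H1Complex.KinvK B11Eq103H1Complex.G1LatticeK
    exact greenK_apply _ w
  have e3 : Kp z = Kp (QU (GU (LinearMap.adjoint QU (KU z)))) := by rw [hR]
  have eX : ∀ w, TGd w = Gt w - GU w := fun w => by rw [hTGd, LinearMap.coe_toContinuousLinearMap', LinearMap.sub_apply]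
  have hid : Kp z - KU z = -((Kpcl ∘L (TQU ∘L (TGd ∘L (SU ∘L KUcl)))) z) := by
    rw [ContinuousLinearMap.comp_apply, ContinuousLinearMap.comp_apply, ContinuousLinearMap.comp_apply, ContinuousLinearMap.comp_apply,
      hKUcl, LinearMap.coe_toContinuousLinearMap', hSU, LinearMap.coe_toContinuousLinearMap', eX, hTQU, LinearMap.coe_toContinuousLinearMap',
      hKpcl, LinearMap.coe_toContinuousLinearMap', map_sub, map_sub, hL', e3]
    abel
  rw [hid, show WL2.equiv ℂ (fun _ : Bond d m => c₁) W (-((Kpcl ∘L (TQU ∘L (TGd ∘L (SU ∘L KUcl)))) z)) c =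
      -(WL2.equiv ℂ (fun _ : Bond d m => c₁) W ((Kpcl ∘L (TQU ∘L (TGd ∘L (SU ∘L KUcl)))) z) c) from rfl, norm_neg]
  refine hc4.trans (le_of_eq ?_)
  simp only [hK, hpiC]
  ring

end Literature.MathematicalPhysics.QuantumFieldTheory.Balaban1983to89.B9Eq3132KinvPiSubKinvLetterTower

end
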